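import Summits.PneNP.PneNP.Theorems.OneSliceSingleThresholdTwoRoundTransfer
import Summits.PneNP.PneNP.Theorems.SingleThreshold.Negative.LoadBearing
import Literature.Computability.Complexity.GnpSprinkling
import Literature.Computability.Complexity.RossmanMonotoneCliqueThm2Proofs
import Literature.Computability.Complexity.Rossman2008CliqueProofs

/-!
# NoisyIndist is monotone in the background density (the background dial)

Route `OneSlice`, crux `Summit.PneNP.PneNP.Theses.OneSlice.SingleThreshold` (stmt-PneNP-2833), line
`two-round-exposure`: the registered stub `stub_backgroundMonotone` (stub H), the transfer behind
the kernel-checked composition `SingleThreshold_of_nis` of the line's skeleton.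

**What.** At one `n`, write `a ⊕ b = a + b − ab` and, for a monotone `{∧₂, ∨₂, 0, 1}`-circuit `D`
on the edges of `K_n` and a background density `q`, the (noisy-planted) ADVANTAGE
`adv_q(D) = Σ_x w_q(x)·Pr_A[D(x ∪ K_A) = 1] − Pr_q[D = 1]` (`A` a uniform `k`-set). If every
monotone01 circuit of size `≤ s + 1` has `adv_{q_b} ≤ γ`, then every monotone01 circuit of size
`≤ s` has `adv_{q_a ⊕ q_b} ≤ γ` (`0 ≤ q_a ≤ 1`; nothing is assumed about `q_b`).

**How.** `G(n, q_a ⊕ q_b) = S_a ∪ S_b` with independent rounds `S_a ∼ G(n, q_a)`,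
`S_b ∼ G(n, q_b)` (union law `sum_sum_gnpWeight_mul_sup`); for each first round `y` the restriction
`D^y : z ↦ D(y ∪ z)` is a monotone01 circuit with at most one more gate
(`Circuit.exists_restrict_sup`), so the hypothesis bounds its `q_b`-advantage by `γ`, and averaging
over `y` with the probability weights `w_{q_a}` gives the claim. This bookkeeping is exactly the
landed two-round exposure `adv_union_le` (`OneSliceSingleThresholdTwoRoundTransfer.lean`), whose
hypothesis quantifies over circuits of size `≤ D.size + 1 ≤ s + 1`.

## References

* B. Rossman, *The monotone complexity of k-clique on random graphs*, FOCS 2010, 193–201; SIAM J.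
  Comput. 43 (2014) 256–279 — §7 (p. 10) and Appendix B (proof of Lemma 17, p. 14) [Rossman2010].
-/

noncomputable section

set_option linter.dupNamespace false

open Finset Filter

open scoped Classical

namespace Summit.PneNP.PneNP.Theorems.SingleThreshold

open Literature.Computability.Complexity GateList
open Summit.PneNP.PneNP.Theorems.SingleThreshold.Negative (Edges)

/-- **NoisyIndist is monotone in the background density** (stub H of the line
`two-round-exposure`). At one `n`: if every monotone `{∧₂, ∨₂, 0, 1}`-circuit of size `≤ s + 1` has
noisy-planted advantage `Σ_x w_{q_b}(x)·Pr_A[D(x ∪ K_A) = 1] − Pr_{q_b}[D = 1] ≤ γ` over the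
background `G(n, q_b)`, then every monotone01 circuit `D` of size `≤ s` has advantage `≤ γ` over the
denser background `G(n, q_a + q_b − q_a q_b)` (`0 ≤ q_a ≤ 1`). Proof: two-round exposure
`G(n, q_a ⊕ q_b) = S_a ∪ S_b` (union law), absorbing the first round into the circuit by the
restriction `D^y = D(y ∪ ·)` (one more gate) and averaging over `y ∼ G(n, q_a)` — i.e.
`adv_union_le` with the size bound `D.size + 1 ≤ s + 1`. [folklore] -/
theorem stub_backgroundMonotone {n k s : ℕ} {qa qb γ : ℝ} (hqa0 : 0 ≤ qa) (hqa1 : qa ≤ 1)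
    (h : ∀ D : Circuit (Edges n), D.IsOver monotoneBasis01 → D.size ≤ s + 1 →
      (∑ x : Edges n → Bool, gnpWeight n qb x *
          kSubsetProb n k (fun A => D.eval (x ⊔ cliqueVec A) = true)) -
        gnpProb n qb (univ.filter fun x => D.eval x = true) ≤ γ)
    (D : Circuit (Edges n)) (hD : D.IsOver monotoneBasis01) (hsize : D.size ≤ s) :
    (∑ x : Edges n → Bool, gnpWeight n (qa + qb - qa * qb) x *
        kSubsetProb n k (fun A => D.eval (x ⊔ cliqueVec A) = true)) -
      gnpProb n (qa + qb - qa * qb) (univ.filter fun x => D.eval x = true) ≤ γ :=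
  adv_union_le hqa0 hqa1 D hD fun D' hD' hsize' => h D' hD' (by omega)

end Summit.PneNP.PneNP.Theorems.SingleThreshold

end
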